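import Summits.Ventures.PercRepro.SixFourResidueThreeOnePoint

/-!
# The `t = 3` clause of `SixFourResidue` — plane + two points (Theorem 21.6 at `t = 3`), part A: the regrouped sum

`G = τ ⊔ {a, a′}` with `τ = P₀ ∩ G` a plane trace of `g − 2` points.  The rank-`4` subsets of `G` are of four kinds:
`B″ ∪ {a}`, `B″ ∪ {a′}`, `B″ ∪ {a, a′}` with `B″ ∈ R₃(τ)` (the three families of `SixFourResidueTwoPointsB`), and the
β-sets `L′ ∪ {a, a′}` with `L′ ⊆ τ` of rank `2` (`R4_subset_families`).  At `t = 3` the first three contribute at least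
`6/(2 + k) + 3/(1 + k) − (12/5)·[|τ ∖ B″| ≥ 2] − (6/5)·[r(τ ∖ B″) = 3]` per `B″` (`share3C`, `dem2`, `dem3`), and a
β-set at least `−3/5` (`|L′| = 2`: an independent `4`-set, `w_∞ = 1/5`) or `−1/5` (`|L′| ≥ 3`: the coloops are among
`a, a′`, `w_∞ ≥ 1/3`) — `jterm3_beta_ge`.  The regrouped lower bound is `J_three_ge_shares₂`.  Part B counts.
-/

namespace PercRepro.SixFour

open Finset ThmH

variable {α : Type*} [DecidableEq α] {M : Matroid α} [M.Finite] {G : Finset α}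

/-- The share of `B″` at `t = 3` over two points: `6/(2 + k) + 3/(1 + k)`. -/
noncomputable def share3C (M : Matroid α) [M.Finite] (S : Finset α) : ℚ :=
  6 / (2 + (kcol M S : ℚ)) + 3 / (1 + (kcol M S : ℚ))

/-- The demand indicator of `B″ ∪ {a}` at `t = 3`: `1` when `r(τ ∖ B″) ≥ 2` (i.e. `¬ (r(τ ∖ B″) + 2 ≤ 3)`). -/
noncomputable def dem2 (M : Matroid α) [M.Finite] (τ B : Finset α) : ℚ :=
  if M.eRk ((τ \ B : Finset α) : Set α) + 2 ≤ (3 : ℕ∞) then 0 else 1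

/-- The rank-`2` subsets of `τ`. -/
noncomputable def R2 (M : Matroid α) [M.Finite] (τ : Finset α) : Finset (Finset α) :=
  τ.powerset.filter (fun S => M.eRk (S : Set α) = 2)

omit [DecidableEq α] in
/-- Membership in `R2`. -/
theorem mem_R2 {τ S : Finset α} : S ∈ R2 M τ ↔ S ⊆ τ ∧ M.eRk (S : Set α) = 2 := by
  unfold R2
  rw [Finset.mem_filter, Finset.mem_powerset]

/-- The lower bound of a β-set's term: `−3/5` for `|L′| = 2`, `−1/5` for `|L′| ≥ 3`. -/
def betaLB (S : Finset α) : ℚ := if S.card = 2 then -3 / 5 else -1 / 5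

/-- `m(B) ≤ |B|`. -/
theorem mTr_le_card (B : Finset α) : mTr M B ≤ B.card := by
  unfold mTr coloopsOf
  exact Finset.card_filter_le _ _

section PlaneTwo

variable {P₀ : Finset α} {a a' : α} (ht : TwoOff M G P₀ a a') (hG : G ⊆ gr M) (hr : M.eRk (G : Set α) = 4)
  (hP₀ : P₀ ∈ planes M)
include ht hG hP₀

omit hG hP₀ in
/-- Insertion of `{a, a′}` is injective on the subsets of `τ`. -/
theorem insert_insert_injOn_powerset :
    Set.InjOn (fun B : Finset α => insert a (insert a' B)) ((P₀ ∩ G).powerset : Set (Finset α)) := by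
  intro B₁ h₁ B₂ h₂ heq
  rw [Finset.mem_coe, Finset.mem_powerset] at h₁ h₂
  obtain ⟨ha₁, ha'₁⟩ := notMem_of_subset_τ ht h₁
  obtain ⟨ha₂, ha'₂⟩ := notMem_of_subset_τ ht h₂
  have h : ((insert a (insert a' B₁)).erase a).erase a' = ((insert a (insert a' B₂)).erase a).erase a' := by
    simp only at heq
    rw [heq]
  have hn₁ : a ∉ insert a' B₁ := by rw [Finset.mem_insert]; push Not; exact ⟨ht.ne, ha₁⟩
  have hn₂ : a ∉ insert a' B₂ := by rw [Finset.mem_insert]; push Not; exact ⟨ht.ne, ha₂⟩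
  have e₁ : ((insert a (insert a' B₁)).erase a).erase a' = B₁ := by
    rw [Finset.erase_insert hn₁, Finset.erase_insert ha'₁]
  have e₂ : ((insert a (insert a' B₂)).erase a).erase a' = B₂ := by
    rw [Finset.erase_insert hn₂, Finset.erase_insert ha'₂]
  rw [e₁, e₂] at h
  exact h

/-- `f₃(B″ ∪ {a}) ≥ 3/(2 + k) − (6/5)·dem₂(B″)`. -/
theorem jterm3_insert_a_ge₂ {B : Finset α} (hB : B ∈ R3 M (P₀ ∩ G)) :
    3 / (2 + (kcol M B : ℚ)) - 6 / 5 * dem2 M (P₀ ∩ G) B ≤ jterm3 M G (insert a B) := by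
  obtain ⟨hBτ, -⟩ := mem_R3.1 hB
  have hw := wInf_insert_ge hP₀ (hBτ.trans Finset.inter_subset_left) (x := a) ht.aP
  have h3 : (3 : ℚ) / (2 + (kcol M B : ℚ)) = 3 * (1 / (2 + (kcol M B : ℚ))) := by ring
  unfold jterm3 dem2
  rw [sdiff_insert_eq ht hBτ, eRk_insert_of_notMem_plane hP₀ (Finset.sdiff_subset.trans Finset.inter_subset_left)
    (hG ht.a'G) ht.a'P, add_assoc, show (1 : ℕ∞) + 1 = 2 by norm_num, h3]
  split_ifs <;> linarith

/-- `f₃(B″ ∪ {a′}) ≥ 3/(2 + k) − (6/5)·dem₂(B″)`. -/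
theorem jterm3_insert_a'_ge₂ {B : Finset α} (hB : B ∈ R3 M (P₀ ∩ G)) :
    3 / (2 + (kcol M B : ℚ)) - 6 / 5 * dem2 M (P₀ ∩ G) B ≤ jterm3 M G (insert a' B) := by
  obtain ⟨hBτ, -⟩ := mem_R3.1 hB
  have hw := wInf_insert_ge hP₀ (hBτ.trans Finset.inter_subset_left) (x := a') ht.a'P
  have h3 : (3 : ℚ) / (2 + (kcol M B : ℚ)) = 3 * (1 / (2 + (kcol M B : ℚ))) := by ring
  unfold jterm3 dem2
  rw [sdiff_insert_eq' ht hBτ, eRk_insert_of_notMem_plane hP₀ (Finset.sdiff_subset.trans Finset.inter_subset_left)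
    (hG ht.aG) ht.aP, add_assoc, show (1 : ℕ∞) + 1 = 2 by norm_num, h3]
  split_ifs <;> linarith

include hr in
/-- `f₃(B″ ∪ {a, a′}) ≥ 3/(1 + k) − (6/5)·dem₃(B″)`. -/
theorem jterm3_insert_aa'_ge₂ {B : Finset α} (hB : B ∈ R3 M (P₀ ∩ G)) :
    3 / (1 + (kcol M B : ℚ)) - 6 / 5 * dem3 M (P₀ ∩ G) B ≤ jterm3 M G (insert a (insert a' B)) := by
  obtain ⟨hBτ, hB3⟩ := mem_R3.1 hB
  have hw := wInf_insert_insert_ge hG hr hP₀ (hBτ.trans Finset.inter_subset_left) (hBτ.trans Finset.inter_subset_right)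
    hB3 ht.aG ht.a'G ht.aP ht.a'P ht.ne
  have h3 : (3 : ℚ) / (1 + (kcol M B : ℚ)) = 3 * (1 / (1 + (kcol M B : ℚ))) := by ring
  unfold jterm3 dem3
  rw [sdiff_insert_insert_eq ht B, h3]
  split_ifs <;> linarith

omit hP₀ in
/-- The coloops of a β-set `L′ ∪ {a, a′}` with `|L′| ≥ 3` are among `a, a′`. -/
theorem coloopsOf_beta_subset (hs : Simple M) {L : Finset α} (hL : L ∈ R2 M (P₀ ∩ G)) (h3 : 3 ≤ L.card) :
    coloopsOf M (insert a (insert a' L)) ⊆ {a, a'} := by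
  obtain ⟨hLτ, hL2⟩ := mem_R2.1 hL
  have hτ : P₀ ∩ G ⊆ gr M := Finset.inter_subset_right.trans hG
  intro y hy
  rw [mem_coloopsOf] at hy
  obtain ⟨hyB, hyc⟩ := hy
  rw [Finset.mem_insert, Finset.mem_singleton]
  by_contra hya
  push Not at hya
  have hyL : y ∈ L := by
    rw [Finset.mem_insert, Finset.mem_insert] at hyB
    rcases hyB with rfl | rfl | h
    · exact absurd rfl hya.1
    · exact absurd rfl hya.2
    · exact h
  -- `y ∈ cl(L ∖ y)`: otherwise `r(L) = r(L ∖ y) + 1 ≥ 3`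
  have hyE : y ∈ M.E := by rw [← coe_gr]; exact_mod_cast hτ (hLτ hyL)
  have hmem : y ∈ M.closure ((L.erase y : Finset α) : Set α) := by
    by_contra hnot
    have h1 := Matroid.eRk_insert_eq_add_one (M := M) (e := y) (X := ((L.erase y : Finset α) : Set α)) ⟨hyE, hnot⟩
    rw [← Finset.coe_insert, Finset.insert_erase hyL, hL2] at h1
    have h2 := two_le_eRk_of_two_le_card hs hτ ((Finset.erase_subset y L).trans hLτ)
      (by rw [Finset.card_erase_of_mem hyL]; omega)
    have : (3 : ℕ∞) ≤ 2 := by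
      calc (3 : ℕ∞) = 2 + 1 := by norm_num
        _ ≤ M.eRk ((L.erase y : Finset α) : Set α) + 1 := add_le_add_left h2 1
        _ = 2 := h1.symm
    exact absurd this (by decide)
  apply hyc
  apply M.closure_subset_closure _ hmem
  rw [Finset.coe_subset]
  intro z hz
  rw [Finset.mem_erase] at hz ⊢
  exact ⟨hz.1, Finset.mem_insert_of_mem (Finset.mem_insert_of_mem hz.2)⟩

omit hP₀ in
/-- **The β-bound**: `f₃(L′ ∪ {a, a′}) ≥ −3/5` when `|L′| = 2` and `≥ −1/5` when `|L′| ≥ 3`. -/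
theorem jterm3_beta_ge (hs : Simple M) {L : Finset α} (hL : L ∈ R2 M (P₀ ∩ G)) :
    betaLB L ≤ jterm3 M G (insert a (insert a' L)) := by
  obtain ⟨hLτ, hL2⟩ := mem_R2.1 hL
  obtain ⟨haL, ha'L⟩ := notMem_of_subset_τ ht hLτ
  have hcard : (insert a (insert a' L)).card = L.card + 2 := by
    rw [Finset.card_insert_of_notMem (by rw [Finset.mem_insert]; push Not; exact ⟨ht.ne, haL⟩),
      Finset.card_insert_of_notMem ha'L]
  have h2 : 2 ≤ L.card := by
    by_contra h
    have hle := M.eRk_le_encard (L : Set α)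
    rw [Set.encard_coe_eq_coe_finsetCard, hL2] at hle
    have : L.card ≤ 1 := by omega
    have h1 : ((L.card : ℕ) : ℕ∞) ≤ 1 := by exact_mod_cast this
    exact absurd (hle.trans h1) (by decide)
  have hind : (if M.eRk ((G \ insert a (insert a' L) : Finset α) : Set α) + 1 ≤ (3 : ℕ∞) then (0 : ℚ) else 1) ≤ 1 := by
    split_ifs <;> norm_num
  unfold jterm3
  by_cases hc : L.card = 2
  · -- an independent `4`-set: `m ≤ 4`, `w_∞ ≥ 1/5`
    rw [betaLB, if_pos hc]
    have hm : mTr M (insert a (insert a' L)) ≤ 4 := by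
      have := mTr_le_card (M := M) (insert a (insert a' L))
      omega
    have hw : (1 / 5 : ℚ) ≤ wInf M (insert a (insert a' L)) := by
      unfold wInf
      apply one_div_le_one_div_of_le (by positivity)
      have : ((mTr M (insert a (insert a' L)) : ℕ) : ℚ) ≤ 4 := by exact_mod_cast hm
      linarith
    linarith
  · -- `|L′| ≥ 3`: the coloops are among `a, a′`, `m ≤ 2`, `w_∞ ≥ 1/3`
    rw [betaLB, if_neg hc]
    have h3 : 3 ≤ L.card := by omega
    have hm : mTr M (insert a (insert a' L)) ≤ 2 := by
      unfold mTr
      calc (coloopsOf M (insert a (insert a' L))).card ≤ ({a, a'} : Finset α).card :=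
            Finset.card_le_card (coloopsOf_beta_subset ht hG hs hL h3)
        _ ≤ 2 := Finset.card_le_two
    have hw : (1 / 3 : ℚ) ≤ wInf M (insert a (insert a' L)) := by
      unfold wInf
      apply one_div_le_one_div_of_le (by positivity)
      have : ((mTr M (insert a (insert a' L)) : ℕ) : ℚ) ≤ 2 := by exact_mod_cast hm
      linarith
    linarith

/-- **The four kinds**: a rank-`4` subset of `G` not of the three `R₃(τ)`-kinds is a β-set `L′ ∪ {a, a′}`, `L′ ∈ R₂(τ)`. -/
theorem mem_beta_of_notMem {B : Finset α} (hB : B ∈ R4 M G)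
    (hnot : B ∉ (R3 M (P₀ ∩ G)).image (fun B : Finset α => insert a B) ∪
      (R3 M (P₀ ∩ G)).image (fun B : Finset α => insert a' B) ∪
      (R3 M (P₀ ∩ G)).image (fun B : Finset α => insert a (insert a' B))) :
    B ∈ (R2 M (P₀ ∩ G)).image (fun B : Finset α => insert a (insert a' B)) := by
  set τ := P₀ ∩ G with hτ
  obtain ⟨hBG, hB4⟩ := mem_R4.1 hB
  rw [Finset.mem_union, Finset.mem_union] at hnot
  push Not at hnot
  by_cases haB : a ∈ B <;> by_cases ha'B : a' ∈ B
  · -- both: `B = B″ ∪ {a, a′}`; `r(B″) = 3` is excluded, `r(B″) ≤ 1` is impossible, so `r(B″) = 2`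
    set B'' := (B.erase a).erase a' with hB''
    have hB''τ : B'' ⊆ τ := subset_τ_of_notMem ht ((Finset.erase_subset _ _).trans ((Finset.erase_subset _ _).trans hBG))
      (fun h => (Finset.mem_erase.1 (Finset.mem_erase.1 h).2).1 rfl) (fun h => (Finset.mem_erase.1 h).1 rfl)
    have hBeq : B = insert a (insert a' B'') := by
      rw [hB'', Finset.insert_erase (Finset.mem_erase.2 ⟨ht.ne.symm, ha'B⟩), Finset.insert_erase haB]
    have hle3 : M.eRk (B'' : Set α) ≤ 3 := by
      rw [← (mem_planes.1 hP₀).2.2]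
      exact M.eRk_mono (Finset.coe_subset.2 (hB''τ.trans Finset.inter_subset_left))
    have hne3 : M.eRk (B'' : Set α) ≠ 3 := by
      intro h3
      apply hnot.2
      rw [Finset.mem_image]
      exact ⟨B'', mem_R3.2 ⟨hB''τ, h3⟩, hBeq.symm⟩
    -- `r(B) ≤ r(B″) + 2`
    have hge2 : 2 ≤ M.eRk (B'' : Set α) := by
      have h1 : M.eRk ((insert a (insert a' B'') : Finset α) : Set α) ≤ M.eRk ((insert a' B'' : Finset α) : Set α) + 1 := by
        rw [Finset.coe_insert]; exact M.eRk_insert_le_add_one _ _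
      have h2 : M.eRk ((insert a' B'' : Finset α) : Set α) ≤ M.eRk (B'' : Set α) + 1 := by
        rw [Finset.coe_insert]; exact M.eRk_insert_le_add_one _ _
      rw [← hBeq, hB4] at h1
      by_contra hlt
      push Not at hlt
      obtain ⟨n, hn, -⟩ := eRk_eq_nat M B''
      rw [hn] at hlt h2
      have hn2 : n < 2 := by exact_mod_cast hlt
      have : (4 : ℕ∞) ≤ ((n : ℕ) : ℕ∞) + 1 + 1 := h1.trans (add_le_add_left h2 1)
      have h' : (4 : ℕ) ≤ n + 1 + 1 := by exact_mod_cast this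
      omega
    have h2 : M.eRk (B'' : Set α) = 2 := by
      obtain ⟨n, hn, -⟩ := eRk_eq_nat M B''
      rw [hn] at hle3 hne3 hge2 ⊢
      have a1 : n ≤ 3 := by exact_mod_cast hle3
      have a2 : 2 ≤ n := by exact_mod_cast hge2
      have a3 : n ≠ 3 := fun h => hne3 (by rw [h]; rfl)
      have : n = 2 := by omega
      rw [this]; rfl
    rw [Finset.mem_image]
    exact ⟨B'', mem_R2.2 ⟨hB''τ, h2⟩, hBeq.symm⟩
  · exfalso
    apply hnot.1.1
    set B'' := B.erase a with hB''
    have hB''τ : B'' ⊆ τ := subset_τ_of_notMem ht ((Finset.erase_subset _ _).trans hBG)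
      (fun h => (Finset.mem_erase.1 h).1 rfl) (fun h => ha'B (Finset.mem_erase.1 h).2)
    have hBeq : B = insert a B'' := by rw [hB'', Finset.insert_erase haB]
    have h3 : M.eRk ((B'' : Finset α) : Set α) = 3 := by
      apply eRk_eq_three_of_add_one
      rw [← eRk_insert_of_notMem_plane hP₀ (hB''τ.trans Finset.inter_subset_left) (hG ht.aG) ht.aP, ← hBeq, hB4]
    rw [Finset.mem_image]
    exact ⟨B'', mem_R3.2 ⟨hB''τ, h3⟩, hBeq.symm⟩
  · exfalso
    apply hnot.1.2
    set B'' := B.erase a' with hB''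
    have hB''τ : B'' ⊆ τ := subset_τ_of_notMem ht ((Finset.erase_subset _ _).trans hBG)
      (fun h => haB (Finset.mem_erase.1 h).2) (fun h => (Finset.mem_erase.1 h).1 rfl)
    have hBeq : B = insert a' B'' := by rw [hB'', Finset.insert_erase ha'B]
    have h3 : M.eRk ((B'' : Finset α) : Set α) = 3 := by
      apply eRk_eq_three_of_add_one
      rw [← eRk_insert_of_notMem_plane hP₀ (hB''τ.trans Finset.inter_subset_left) (hG ht.a'G) ht.a'P, ← hBeq, hB4]
    rw [Finset.mem_image]
    exact ⟨B'', mem_R3.2 ⟨hB''τ, h3⟩, hBeq.symm⟩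
  · exfalso
    have hBτ := subset_τ_of_notMem ht hBG haB ha'B
    have : M.eRk (B : Set α) ≤ 3 := by
      rw [← (mem_planes.1 hP₀).2.2]
      exact M.eRk_mono (Finset.coe_subset.2 (hBτ.trans Finset.inter_subset_left))
    rw [hB4] at this
    exact absurd this (by decide)

include hr in
/-- **The regrouped sum at `t = 3`**: `Σ_{B″ ∈ R₃(τ)} (c₃(B″) − (12/5)·dem₂(B″) − (6/5)·dem₃(B″)) + Σ_{L′ ∈ R₂(τ)} β(L′) ≤ J₃(G)`. -/
theorem J_three_ge_shares₂ (hs : Simple M) :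
    ∑ B ∈ R3 M (P₀ ∩ G), (share3C M B - 12 / 5 * dem2 M (P₀ ∩ G) B - 6 / 5 * dem3 M (P₀ ∩ G) B) +
      ∑ L ∈ R2 M (P₀ ∩ G), betaLB L ≤ J M G 3 := by
  set τ := P₀ ∩ G with hτ
  set S₁ := (R3 M τ).image (fun B : Finset α => insert a B) with hS₁
  set S₂ := (R3 M τ).image (fun B : Finset α => insert a' B) with hS₂
  set S₃ := (R3 M τ).image (fun B : Finset α => insert a (insert a' B)) with hS₃
  set Sβ := (R2 M τ).image (fun B : Finset α => insert a (insert a' B)) with hSβ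
  have hsub : S₁ ∪ S₂ ∪ S₃ ⊆ R4 M G := by
    intro B hB
    rw [Finset.mem_union, Finset.mem_union, hS₁, hS₂, hS₃, Finset.mem_image, Finset.mem_image, Finset.mem_image] at hB
    rcases hB with (⟨B'', h, rfl⟩ | ⟨B'', h, rfl⟩) | ⟨B'', h, rfl⟩
    · exact insert_a_mem_R4 ht hG hP₀ h
    · exact insert_a'_mem_R4 ht hG hP₀ h
    · exact insert_aa'_mem_R4 ht hG hr hP₀ h
  have hmem₁ : ∀ B ∈ S₁, a' ∉ B := by
    intro B hB
    rw [hS₁, Finset.mem_image] at hB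
    obtain ⟨B'', h, rfl⟩ := hB
    rw [Finset.mem_insert]
    push Not
    exact ⟨ht.ne.symm, (notMem_of_subset_τ ht (mem_R3.1 h).1).2⟩
  have hmem₂ : ∀ B ∈ S₂, a ∉ B := by
    intro B hB
    rw [hS₂, Finset.mem_image] at hB
    obtain ⟨B'', h, rfl⟩ := hB
    rw [Finset.mem_insert]
    push Not
    exact ⟨ht.ne, (notMem_of_subset_τ ht (mem_R3.1 h).1).1⟩
  have hmem₃ : ∀ B ∈ S₃, a ∈ B ∧ a' ∈ B := by
    intro B hB
    rw [hS₃, Finset.mem_image] at hB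
    obtain ⟨B'', -, rfl⟩ := hB
    exact ⟨Finset.mem_insert_self _ _, Finset.mem_insert_of_mem (Finset.mem_insert_self _ _)⟩
  have hd₁₂ : Disjoint S₁ S₂ := by
    rw [Finset.disjoint_left]
    intro B h₁ h₂
    rw [hS₂, Finset.mem_image] at h₂
    obtain ⟨B'', -, rfl⟩ := h₂
    exact hmem₁ _ h₁ (Finset.mem_insert_self _ _)
  have hd₁₂₃ : Disjoint (S₁ ∪ S₂) S₃ := by
    rw [Finset.disjoint_left]
    intro B h₁₂ h₃
    rw [Finset.mem_union] at h₁₂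
    rcases h₁₂ with h | h
    · exact hmem₁ _ h (hmem₃ _ h₃).2
    · exact hmem₂ _ h (hmem₃ _ h₃).1
  -- the three families
  have hper : ∀ B ∈ R3 M τ, share3C M B - 12 / 5 * dem2 M τ B - 6 / 5 * dem3 M τ B ≤
      jterm3 M G (insert a B) + jterm3 M G (insert a' B) + jterm3 M G (insert a (insert a' B)) := by
    intro B hB
    have h1 := jterm3_insert_a_ge₂ ht hG hP₀ hB
    have h2 := jterm3_insert_a'_ge₂ ht hG hP₀ hB
    have h3 := jterm3_insert_aa'_ge₂ ht hG hr hP₀ hB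
    unfold share3C
    have e : (6 : ℚ) / (2 + (kcol M B : ℚ)) = 3 / (2 + (kcol M B : ℚ)) + 3 / (2 + (kcol M B : ℚ)) := by ring
    rw [e]
    linarith
  have hA : ∑ B ∈ R3 M τ, (share3C M B - 12 / 5 * dem2 M τ B - 6 / 5 * dem3 M τ B) ≤
      ∑ B ∈ S₁ ∪ S₂ ∪ S₃, jterm3 M G B := by
    calc ∑ B ∈ R3 M τ, (share3C M B - 12 / 5 * dem2 M τ B - 6 / 5 * dem3 M τ B)
        ≤ ∑ B ∈ R3 M τ, (jterm3 M G (insert a B) + jterm3 M G (insert a' B) + jterm3 M G (insert a (insert a' B))) :=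
          Finset.sum_le_sum hper
      _ = ∑ B ∈ S₁, jterm3 M G B + ∑ B ∈ S₂, jterm3 M G B + ∑ B ∈ S₃, jterm3 M G B := by
          rw [Finset.sum_add_distrib, Finset.sum_add_distrib, hS₁, hS₂, hS₃,
            Finset.sum_image (insert_injOn a ht.aP), Finset.sum_image (insert_injOn a' ht.a'P),
            Finset.sum_image (insert_insert_injOn ht)]
      _ = ∑ B ∈ S₁ ∪ S₂ ∪ S₃, jterm3 M G B := by
          rw [Finset.sum_union hd₁₂₃, Finset.sum_union hd₁₂]
  -- the β-sets: the rest of `R₄(G)` lies in `Sβ`, with terms `≥ betaLB`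
  have hrest : R4 M G \ (S₁ ∪ S₂ ∪ S₃) ⊆ Sβ := by
    intro B hB
    rw [Finset.mem_sdiff] at hB
    exact mem_beta_of_notMem ht hG hP₀ hB.1 hB.2
  have hβ : ∀ B ∈ Sβ, betaLB ((B.erase a).erase a') ≤ jterm3 M G B ∧ betaLB ((B.erase a).erase a') ≤ 0 := by
    intro B hB
    rw [hSβ, Finset.mem_image] at hB
    obtain ⟨L, hL, rfl⟩ := hB
    obtain ⟨haL, ha'L⟩ := notMem_of_subset_τ ht (mem_R2.1 hL).1
    have hLe : ((insert a (insert a' L)).erase a).erase a' = L := by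
      rw [Finset.erase_insert (by rw [Finset.mem_insert]; push Not; exact ⟨ht.ne, haL⟩), Finset.erase_insert ha'L]
    rw [hLe]
    refine ⟨jterm3_beta_ge ht hG hs hL, ?_⟩
    unfold betaLB
    split_ifs <;> norm_num
  have hB : ∑ L ∈ R2 M τ, betaLB L ≤ ∑ B ∈ R4 M G \ (S₁ ∪ S₂ ∪ S₃), jterm3 M G B := by
    calc ∑ L ∈ R2 M τ, betaLB L = ∑ B ∈ Sβ, betaLB ((B.erase a).erase a') := by
          rw [hSβ, Finset.sum_image (insert_insert_injOn_powerset ht |>.mono (fun L hL => by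
            rw [Finset.mem_coe] at hL ⊢
            rw [Finset.mem_powerset]
            exact (mem_R2.1 hL).1))]
          refine Finset.sum_congr rfl (fun L hL => ?_)
          obtain ⟨haL, ha'L⟩ := notMem_of_subset_τ ht (mem_R2.1 hL).1
          rw [Finset.erase_insert (by rw [Finset.mem_insert]; push Not; exact ⟨ht.ne, haL⟩), Finset.erase_insert ha'L]
      _ ≤ ∑ B ∈ R4 M G \ (S₁ ∪ S₂ ∪ S₃), betaLB ((B.erase a).erase a') := by
          have := Finset.sum_le_sum_of_subset_of_nonneg (f := fun B : Finset α => -betaLB ((B.erase a).erase a')) hrest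
            (fun B hB _ => by have := (hβ B hB).2; linarith)
          rw [Finset.sum_neg_distrib, Finset.sum_neg_distrib] at this
          linarith
      _ ≤ ∑ B ∈ R4 M G \ (S₁ ∪ S₂ ∪ S₃), jterm3 M G B :=
          Finset.sum_le_sum (fun B hB => (hβ B (hrest hB)).1)
  rw [J_three_eq_sum_jterm3, ← Finset.sum_sdiff hsub]
  linarith

end PlaneTwo

end PercRepro.SixFour
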